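import Mathlib.Analysis.InnerProductSpace.PiL2
import Mathlib.Analysis.SpecialFunctions.Exp
import Mathlib.Analysis.Complex.ExponentialBounds
import HarnessLib

/-!
# Five points on `S²`, potentials `(1+⟪x,y⟫)^k`: the triangular bipyramid is NOT optimal for ANY `k ≥ 7`

Framing: lottery ticket; floor = certified bounds/negative ranges. Venture `PackingBounds`, cell
`pub-packcert`, energy family E3PT (pub-packcert-energy gen 17; companion of `Energy/FivePointCkAll.lean`).

`FivePointCkAll` shows: for five unit vectors of `ℝ³` and the potential `(1+t)^k`, the triangular bipyramid's energy
`12 + 6·(1/2)^k` (ordered pairs) is the least value for every `1 ≤ k ≤ 4`, and is not the least value for `k = 7`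
(Cohn–Kumar's square pyramid with apex–base inner product `-4/25`). Here we prove the negative statement for EVERY
`k ≥ 7` at once, with an explicit `k`-dependent square pyramid with RATIONAL coordinates: apex `e₃`, base square at
height `-h`, radius `r`, where `(r, h) = ((m²-1)/(m²+1), 2m/(m²+1))` is the Pythagorean pair with `m = 2k-1`, so that
`h = (2k-1)/(2k²-2k+1)` satisfies `k·h ≥ 1` and `h ≤ 1/(k-1)`. Its energy is `8(1-h)^k + 8(1+h²)^k + 4(2h²)^k`; the three
terms are bounded by `8/e`, `8·exp(k h²) ≤ 8·exp(12/121)` and `4h²` for `k ≥ 12`, which is `< 12`; the cases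
`7 ≤ k ≤ 11` are decided by `norm_num` on the rational values. So the picture for five points is: bipyramid optimal for
`k ≤ 4` (kernel), NOT optimal for every `k ≥ 7` (this file), `k = 5, 6` open (the bipyramid is the numerical optimum; no
three-point certificate of SDP degree `≤ 8` proves it — exact moment-side certificates of the cell, E3PT.md §2n(ii)).

## References
* H. Cohn, A. Kumar, *Universally optimal distribution of points on spheres*, J. Amer. Math. Soc. 20 (2007) 99–148, §1
  (p. 102: the square-pyramid competitor for `(4-r)^7`). [`CohnKumar2006`]
-/

noncomputable section

open Finset Real
open scoped RealInnerProductSpace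

namespace Summit.Ventures.PackingBounds.Energy.FivePointCkLarge

/-- The square pyramid with apex `e₃` and base square `(±r, 0, -h), (0, ±r, -h)`, as an indexed family. -/
def sqPyr (h r : ℝ) : Fin 5 → EuclideanSpace ℝ (Fin 3) :=
  ![!₂[0, 0, 1], !₂[r, 0, -h], !₂[0, r, -h], !₂[-r, 0, -h], !₂[0, -r, -h]]

/-- The Gram table of the square pyramid: `1` on the diagonal, `-h` apex–base, `h²` for adjacent and `2h²-1` for
opposite base points (given `r² + h² = 1`). -/
def gram (h : ℝ) : Fin 5 → Fin 5 → ℝ :=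
  ![![1, -h, -h, -h, -h],
    ![-h, 1, h ^ 2, 2 * h ^ 2 - 1, h ^ 2],
    ![-h, h ^ 2, 1, h ^ 2, 2 * h ^ 2 - 1],
    ![-h, 2 * h ^ 2 - 1, h ^ 2, 1, h ^ 2],
    ![-h, h ^ 2, 2 * h ^ 2 - 1, h ^ 2, 1]]

/-- The inner products of the square pyramid are the entries of `gram h` when `r² + h² = 1`. -/
theorem inner_sqPyr (h r : ℝ) (hr : r ^ 2 + h ^ 2 = 1) (i j : Fin 5) :
    inner ℝ (sqPyr h r i) (sqPyr h r j) = gram h i j := by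
  have hr' : r * r = 1 - h * h := by nlinarith
  fin_cases i <;> fin_cases j <;>
    simp [sqPyr, gram, PiLp.inner_apply, Fin.sum_univ_three, -inner_self_eq_norm_sq_to_K] <;> nlinarith

/-- The points of the square pyramid are unit vectors. -/
theorem norm_sqPyr (h r : ℝ) (hr : r ^ 2 + h ^ 2 = 1) (i : Fin 5) : ‖sqPyr h r i‖ = 1 := by
  have h2 : ‖sqPyr h r i‖ ^ 2 = 1 := by
    rw [← real_inner_self_eq_norm_sq, inner_sqPyr h r hr]
    fin_cases i <;> simp [gram]
  exact (pow_eq_one_iff_of_nonneg (norm_nonneg _) two_ne_zero).mp h2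

/-- Off-diagonal Gram entries are `< 1` when `0 < h < 1`. -/
theorem gram_lt_one (h : ℝ) (h0 : 0 < h) (h1 : h < 1) (i j : Fin 5) (hij : i ≠ j) : gram h i j < 1 := by
  have hh : h ^ 2 < 1 := by nlinarith
  have hab : |h| < 1 := abs_lt.mpr ⟨by linarith, h1⟩
  fin_cases i <;> fin_cases j <;> first | exact absurd rfl hij | (simp [gram, hab]) <;> nlinarith

/-- The square pyramid map is injective when `0 < h < 1` (distinct points have inner product `< 1`). -/
theorem sqPyr_injective (h r : ℝ) (hr : r ^ 2 + h ^ 2 = 1) (h0 : 0 < h) (h1 : h < 1) :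
    Function.Injective (sqPyr h r) := by
  intro i j hij
  by_contra hne
  have hlt := gram_lt_one h h0 h1 i j hne
  rw [← inner_sqPyr h r hr, hij, real_inner_self_eq_norm_sq, norm_sqPyr h r hr] at hlt
  norm_num at hlt

/-- The configuration as a `Finset`. -/
def config (h r : ℝ) : Finset (EuclideanSpace ℝ (Fin 3)) := univ.image (sqPyr h r)

/-- It has five points. -/
theorem card_config (h r : ℝ) (hr : r ^ 2 + h ^ 2 = 1) (h0 : 0 < h) (h1 : h < 1) : (config h r).card = 5 := by
  rw [config, card_image_of_injective _ (sqPyr_injective h r hr h0 h1), card_univ, Fintype.card_fin]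

/-- All its points are unit vectors. -/
theorem norm_config (h r : ℝ) (hr : r ^ 2 + h ^ 2 = 1) : ∀ x ∈ config h r, ‖x‖ = 1 := by
  intro x hx
  obtain ⟨i, -, rfl⟩ := mem_image.mp hx
  exact norm_sqPyr h r hr i

/-- Energy of an injective indexed configuration: the `Finset` double sum is the indexed double sum over `i ≠ j`. -/
theorem energy_image {ι : Type*} [Fintype ι] [DecidableEq ι] {n : ℕ} (v : ι → EuclideanSpace ℝ (Fin n))
    (hv : Function.Injective v) (F : EuclideanSpace ℝ (Fin n) → EuclideanSpace ℝ (Fin n) → ℝ) :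
    ∑ x ∈ univ.image v, ∑ y ∈ (univ.image v).erase x, F x y = ∑ i, ∑ j ∈ univ.erase i, F (v i) (v j) := by
  rw [sum_image fun i _ j _ e => hv e]
  refine sum_congr rfl fun i _ => ?_
  rw [← image_erase hv, sum_image fun a _ b _ e => hv e]

/-- The `(1+t)^k`-energy of the square pyramid: `8(1-h)^k + 8(1+h²)^k + 4(2h²)^k`. -/
theorem energy_config (h r : ℝ) (hr : r ^ 2 + h ^ 2 = 1) (h0 : 0 < h) (h1 : h < 1) (k : ℕ) :
    ∑ x ∈ config h r, ∑ y ∈ (config h r).erase x, (1 + inner ℝ x y) ^ k =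
      8 * (1 - h) ^ k + 8 * (1 + h ^ 2) ^ k + 4 * (2 * h ^ 2) ^ k := by
  rw [config, energy_image _ (sqPyr_injective h r hr h0 h1)]
  simp_rw [inner_sqPyr h r hr]
  simp_rw [sum_erase_eq_sub (mem_univ _)]
  simp [Fin.sum_univ_five, gram]
  ring

/-- The Pythagorean height `h = (2k-1)/(2k²-2k+1)` and radius `r = (2k²-2k)/(2k²-2k+1)` (`m = 2k-1`,
`(r, h) = ((m²-1)/(m²+1), 2m/(m²+1))`). -/
def hk (k : ℕ) : ℝ := (2 * k - 1) / (2 * k ^ 2 - 2 * k + 1)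

/-- The radius of the base square. -/
def rk (k : ℕ) : ℝ := (2 * k ^ 2 - 2 * k) / (2 * k ^ 2 - 2 * k + 1)

/-- `rk² + hk² = 1`. -/
theorem rk_sq_add_hk_sq (k : ℕ) : rk k ^ 2 + hk k ^ 2 = 1 := by
  have hD : (2 * (k : ℝ) ^ 2 - 2 * k + 1) ≠ 0 := by nlinarith [sq_nonneg ((k : ℝ) - 1 / 2)]
  unfold rk hk
  rw [div_pow, div_pow, ← add_div, div_eq_one_iff_eq (pow_ne_zero 2 hD)]
  ring

/-- `0 < hk k` for `k ≥ 1`. -/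
theorem hk_pos (k : ℕ) (hk1 : 1 ≤ k) : 0 < hk k := by
  have hk' : (1 : ℝ) ≤ k := by exact_mod_cast hk1
  unfold hk
  apply div_pos <;> nlinarith

/-- `hk k < 1/(k-1)` for `k ≥ 2`, in the form `hk k * (k - 1) < 1`. -/
theorem hk_mul_lt (k : ℕ) (hk2 : 2 ≤ k) : hk k * ((k : ℝ) - 1) < 1 := by
  have hk' : (2 : ℝ) ≤ k := by exact_mod_cast hk2
  have hD : 0 < (2 * (k : ℝ) ^ 2 - 2 * k + 1) := by nlinarith
  unfold hk
  rw [div_mul_eq_mul_div, div_lt_one hD]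
  nlinarith

/-- `k · hk k ≥ 1` for `k ≥ 1`. -/
theorem one_le_mul_hk (k : ℕ) (hk1 : 1 ≤ k) : 1 ≤ (k : ℝ) * hk k := by
  have hk' : (1 : ℝ) ≤ k := by exact_mod_cast hk1
  have hD : 0 < (2 * (k : ℝ) ^ 2 - 2 * k + 1) := by nlinarith
  unfold hk
  rw [mul_div_assoc', one_le_div hD]
  nlinarith

/-- `hk k < 1` for `k ≥ 2`. -/
theorem hk_lt_one (k : ℕ) (hk2 : 2 ≤ k) : hk k < 1 := by
  have hk' : (2 : ℝ) ≤ k := by exact_mod_cast hk2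
  have := hk_mul_lt k hk2
  nlinarith [hk_pos k (by omega)]

/-- `(1 - h)^k ≤ exp(-1)` when `h ≤ 1` and `k h ≥ 1`. -/
theorem one_sub_pow_le (h : ℝ) (k : ℕ) (h1 : h ≤ 1) (hkh : 1 ≤ (k : ℝ) * h) :
    (1 - h) ^ k ≤ exp (-1) := by
  have h2 : (1 - h) ^ k ≤ exp (-h) ^ k :=
    pow_le_pow_left₀ (by linarith) (by linarith [add_one_le_exp (-h)]) k
  have h3 : exp (-h) ^ k = exp (-((k : ℝ) * h)) := by rw [← exp_nat_mul]; ring_nf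
  rw [h3] at h2
  exact h2.trans (exp_le_exp.mpr (by linarith))

/-- `(1 + h²)^k ≤ exp(k h²)`. -/
theorem one_add_sq_pow_le (h : ℝ) (k : ℕ) : (1 + h ^ 2) ^ k ≤ exp ((k : ℝ) * h ^ 2) := by
  have h2 : (1 + h ^ 2) ^ k ≤ exp (h ^ 2) ^ k :=
    pow_le_pow_left₀ (by positivity) (by linarith [add_one_le_exp (h ^ 2)]) k
  rwa [← exp_nat_mul] at h2

/-- `exp(-1) < 0.3679`. -/
theorem exp_neg_one_lt : exp (-1) < 0.3679 := lt_trans exp_neg_one_lt_d9 (by norm_num)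

/-- `exp(12/121) < 1.1091`. -/
theorem exp_small_lt : exp (12 / 121) < 1.1091 := by
  have h := abs_exp_sub_one_sub_id_le (x := (12 : ℝ) / 121) (by rw [abs_of_nonneg (by norm_num)]; norm_num)
  rw [abs_le] at h
  nlinarith [h.2]

/-- **The analytic case `k ≥ 12`:** the square pyramid with `h = hk k` has energy `< 12`. -/
theorem energy_lt_twelve_of_le (k : ℕ) (hk12 : 12 ≤ k) :
    8 * (1 - hk k) ^ k + 8 * (1 + hk k ^ 2) ^ k + 4 * (2 * hk k ^ 2) ^ k < 12 := by
  set h := hk k with hh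
  have hk' : (12 : ℝ) ≤ k := by exact_mod_cast hk12
  have h0 : 0 < h := hk_pos k (by omega)
  have h1 : h < 1 := hk_lt_one k (by omega)
  have hm : h * ((k : ℝ) - 1) ≤ 1 := (hk_mul_lt k (by omega)).le
  have hkh : 1 ≤ (k : ℝ) * h := one_le_mul_hk k (by omega)
  -- term 1
  have t1 : (1 - h) ^ k ≤ exp (-1) := one_sub_pow_le h k h1.le hkh
  -- term 2: k h² ≤ k/(k-1)² ≤ 12/121
  have hkh2 : (k : ℝ) * h ^ 2 ≤ 12 / 121 := by
    -- h ≤ 1/(k-1) and k/(k-1)^2 ≤ 12/121 for k ≥ 12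
    have hk1 : 0 < (k : ℝ) - 1 := by linarith
    have hle : h ≤ 1 / ((k : ℝ) - 1) := by rw [le_div_iff₀ hk1]; exact hm
    have hsq : h ^ 2 ≤ 1 / ((k : ℝ) - 1) ^ 2 := by
      rw [one_div, ← inv_pow, ← one_div]; gcongr
    have hkk : (k : ℝ) * (1 / ((k : ℝ) - 1) ^ 2) ≤ 12 / 121 := by
      rw [mul_one_div, div_le_div_iff₀ (by positivity) (by norm_num)]
      nlinarith
    calc (k : ℝ) * h ^ 2 ≤ (k : ℝ) * (1 / ((k : ℝ) - 1) ^ 2) := by gcongr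
      _ ≤ 12 / 121 := hkk
  have t2 : (1 + h ^ 2) ^ k ≤ exp (12 / 121) :=
    (one_add_sq_pow_le h k).trans (exp_le_exp.mpr hkh2)
  -- term 3: (2h²)^k ≤ 2h² ≤ 2/121
  have h2sq : 2 * h ^ 2 ≤ 2 / 121 := by
    have : (k : ℝ) * h ^ 2 ≥ 12 * h ^ 2 := by nlinarith
    nlinarith
  have t3 : (2 * h ^ 2) ^ k ≤ 2 * h ^ 2 := by
    calc (2 * h ^ 2) ^ k ≤ (2 * h ^ 2) ^ 1 :=
          pow_le_pow_of_le_one (by positivity) (by nlinarith) (by omega)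
      _ = 2 * h ^ 2 := pow_one _
  nlinarith [exp_neg_one_lt, exp_small_lt, t1, t2, t3, h2sq]

/-- **The small cases `7 ≤ k ≤ 11`:** `norm_num` on the rational energies. -/
theorem energy_lt_of_small (k : ℕ) (hk7 : 7 ≤ k) (hk11 : k ≤ 11) :
    8 * (1 - hk k) ^ k + 8 * (1 + hk k ^ 2) ^ k + 4 * (2 * hk k ^ 2) ^ k < 12 + 6 * (1 / 2 : ℝ) ^ k := by
  interval_cases k <;> (unfold hk; norm_num)

/-- **The square pyramid beats the bipyramid for every `k ≥ 7`.** -/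
theorem energy_lt (k : ℕ) (hk7 : 7 ≤ k) :
    8 * (1 - hk k) ^ k + 8 * (1 + hk k ^ 2) ^ k + 4 * (2 * hk k ^ 2) ^ k < 12 + 6 * (1 / 2 : ℝ) ^ k := by
  by_cases hk12 : 12 ≤ k
  · have hpos : (0 : ℝ) ≤ 6 * (1 / 2 : ℝ) ^ k := by positivity
    linarith [energy_lt_twelve_of_le k hk12]
  · exact energy_lt_of_small k hk7 (by omega)

/-- For every `k ≥ 7` some five-point configuration of `S²` has `(1+t)^k`-energy strictly below the bipyramid's
`12 + 6·(1/2)^k` (explicitly: the square pyramid `config (hk k) (rk k)`). -/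
theorem exists_lt_bipyramid (k : ℕ) (hk7 : 7 ≤ k) :
    ∃ E ∈ {E : ℝ | ∃ C : Finset (EuclideanSpace ℝ (Fin 3)), C.card = 5 ∧ (∀ x ∈ C, ‖x‖ = 1) ∧
      E = ∑ x ∈ C, ∑ y ∈ C.erase x, (1 + inner ℝ x y) ^ k}, E < 12 + 6 * (1 / 2 : ℝ) ^ k := by
  have hr := rk_sq_add_hk_sq k
  have h0 := hk_pos k (by omega)
  have h1 := hk_lt_one k (by omega)
  refine ⟨_, ⟨config (hk k) (rk k), card_config _ _ hr h0 h1, norm_config _ _ hr, rfl⟩, ?_⟩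
  rw [energy_config _ _ hr h0 h1]
  exact energy_lt k hk7

/-- **For every `k ≥ 7` the triangular bipyramid is NOT the `(1+t)^k`-energy minimiser of five points on `S²`:**
`12 + 6·(1/2)^k` is not the least value of `Σ_{x ≠ y} (1+⟪x,y⟫)^k` over five unit vectors of `ℝ³`
(Cohn–Kumar 2007 §1 for `k = 7`; here every `k ≥ 7`, by the `k`-dependent rational square pyramid `config (hk k) (rk k)`). -/
theorem bipyramid_not_isLeast (k : ℕ) (hk7 : 7 ≤ k) :
    ¬ IsLeast {E : ℝ | ∃ C : Finset (EuclideanSpace ℝ (Fin 3)), C.card = 5 ∧ (∀ x ∈ C, ‖x‖ = 1) ∧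
      E = ∑ x ∈ C, ∑ y ∈ C.erase x, (1 + inner ℝ x y) ^ k} (12 + 6 * (1 / 2 : ℝ) ^ k) := by
  intro hL
  obtain ⟨E, hE, hlt⟩ := exists_lt_bipyramid k hk7
  exact absurd (hL.2 hE) (not_le.mpr hlt)

end Summit.Ventures.PackingBounds.Energy.FivePointCkLarge
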